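/-
Origin: expansion seat `planner-pub-hodgecm-qw8-g10-0`, handover #3a (md5 b16f14ffd99d, 304 l.): NEW additive leaf; imports ONLY Mathlib => NO rewrite, any order; frozen copy handover/LefNonNormalField.b16f14ffd99d.lean (`HOME/pub-hodgecm-qw8-g10/lean/Qw8g10/LefNonNormalField.lean`, md5 b16f14ff, 304 lines);
landed by the gen-8 packager in gate run 31 as `HodgeCM/Model/Toy/LefNonNormalField.lean` (verbatim).
-/
-- HANDOVER (planner-pub-hodgecm-qw8-g10-0, unit pub-hodgecm-qw8-g10): WIP module `Qw8g10.LefNonNormalField`; intended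
-- final module `HodgeCM.Model.Toy.LefNonNormalField` (kind L5 support: a concrete quartic field inside `ℂ`, Mathlib only);
-- NEW additive leaf; imports ONLY `Mathlib`; NO rewrite at landing; any order (row #3b `LefNonNormalExample` imports it).
/-
Copyright (c) 2026. All rights reserved.
Released under Apache 2.0 license as described in the file LICENSE.
-/
import Mathlib

/-!
# The quartic field `ℚ(i√(3+√2)) ⊂ ℂ` (towards a non-normal quartic CM field)

Pure algebraic number theory, kernel-checked from Mathlib; nothing cited, no data.  Companion file
`LefNonNormalExample` turns this into the abstract number field `ℚ[X]/(X⁴+6X²+7)`, proves it CM and NOT normal, and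
decides the separating model's mixing criterion for it.

* §1 `quartic := X⁴ + 6X² + 7 = (X²+3)² − 2` and the complex numbers `√2` (`rt2`), `α = i√(3+√2)` (`al`),
  `β = i√(3−√2)` (`be`): `α² = −3 − √2`, `β² = −3 + √2`, both are roots, `αβ = −√7`; NO root of the quartic is real
  (`conj_ne_of_quartic`: a real root `x` would have `x⁴ + 6x² + 7 > 0`); `√2 ∉ ℚ`.
* §2 the intermediate fields `ℚ(√2) ≤ ℚ(α)` of `ℂ/ℚ` and the real line `realIF` as an intermediate field:
  `[ℚ(√2):ℚ] = 2`, `[ℚ(α):ℚ] = 4` (even, divides `4`, and `≠ 2` because `α ∉ ℝ ⊇ ℚ(√2)`), hence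
  `minpoly ℚ α = quartic` and **`quartic_irreducible`**; and the arithmetic heart **`√7 ∉ ℚ(√2)`**
  (`sqrt7_not_mem_adjoin_rt2`: writing `√7 = a√2 + b` over the power basis and squaring forces one of `√2, √7, √14`
  to be rational).
* §3 **`β ∉ ℚ(α)`** (`be_not_mem_adjoin_al`): otherwise `M = ℚ(√2, −√7) ≤ ℚ(α)`; `M` is real and, as `√7 ∉ ℚ(√2)`, of
  degree `4 = [ℚ(α):ℚ]`, so `M = ℚ(α) ∋ α` would be real.  (Hence the two embeddings `a ↦ α`, `a ↦ β` of
  `ℚ[X]/(quartic)` have different images: the field is not normal — next file.)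
-/

noncomputable section

open Polynomial Complex IntermediateField Module

namespace HodgeCM.Toy

/-! ## §1 The roots of `X⁴ + 6X² + 7` in `ℂ` -/

namespace D4

/-- the polynomial `X⁴ + 6X² + 7 = (X² + 3)² − 2` -/
def quartic : ℚ[X] := X ^ 4 + 6 * X ^ 2 + 7

/-- (Ported verbatim from the HodgeCMPerL package; no docstring in the source.) -/
theorem quartic_monic : quartic.Monic := by
  unfold quartic; monicity!

/-- (Ported verbatim from the HodgeCMPerL package; no docstring in the source.) -/
theorem natDegree_quartic : quartic.natDegree = 4 := by
  unfold quartic; compute_degree!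

/-- (Ported verbatim from the HodgeCMPerL package; no docstring in the source.) -/
theorem quartic_ne_zero : quartic ≠ 0 := quartic_monic.ne_zero

/-- evaluation of the quartic under a ring hom `ℚ → R` -/
theorem eval₂_quartic {R : Type*} [CommRing R] (i : ℚ →+* R) (z : R) :
    quartic.eval₂ i z = z ^ 4 + 6 * z ^ 2 + 7 := by
  simp [quartic, eval₂_add, eval₂_mul, eval₂_pow]

/-- `√2`, `α = i·√(3 + √2)` and `β = i·√(3 − √2)` as complex numbers -/
def rt2 : ℂ := (Real.sqrt 2 : ℝ)
/-- (Ported verbatim from the HodgeCMPerL package; no docstring in the source.) -/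
def al : ℂ := I * (Real.sqrt (3 + Real.sqrt 2) : ℝ)
/-- (Ported verbatim from the HodgeCMPerL package; no docstring in the source.) -/
def be : ℂ := I * (Real.sqrt (3 - Real.sqrt 2) : ℝ)

/-- (Ported verbatim from the HodgeCMPerL package; no docstring in the source.) -/
theorem sqrt2_lt_three : Real.sqrt 2 < 3 := by
  have h := Real.sq_sqrt (show (0:ℝ) ≤ 2 by norm_num)
  have h0 := Real.sqrt_nonneg 2
  nlinarith

/-- (Ported verbatim from the HodgeCMPerL package; no docstring in the source.) -/
theorem rt2_sq : rt2 ^ 2 = 2 := by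
  simp only [rt2, ← ofReal_pow, Real.sq_sqrt (show (0:ℝ) ≤ 2 by norm_num)]
  norm_num

/-- (Ported verbatim from the HodgeCMPerL package; no docstring in the source.) -/
theorem al_sq : al ^ 2 = -3 - rt2 := by
  have h : (0:ℝ) ≤ 3 + Real.sqrt 2 := by positivity
  simp only [al, rt2, mul_pow, I_sq, ← ofReal_pow, Real.sq_sqrt h]
  push_cast; ring

/-- (Ported verbatim from the HodgeCMPerL package; no docstring in the source.) -/
theorem be_sq : be ^ 2 = -3 + rt2 := by
  have h : (0:ℝ) ≤ 3 - Real.sqrt 2 := by linarith [sqrt2_lt_three]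
  simp only [be, rt2, mul_pow, I_sq, ← ofReal_pow, Real.sq_sqrt h]
  push_cast; ring

/-- (Ported verbatim from the HodgeCMPerL package; no docstring in the source.) -/
theorem al_quartic : al ^ 4 + 6 * al ^ 2 + 7 = 0 := by
  have : al ^ 4 = (al ^ 2) ^ 2 := by ring
  rw [this, al_sq]; ring_nf; rw [rt2_sq]; ring

/-- (Ported verbatim from the HodgeCMPerL package; no docstring in the source.) -/
theorem be_quartic : be ^ 4 + 6 * be ^ 2 + 7 = 0 := by
  have : be ^ 4 = (be ^ 2) ^ 2 := by ring
  rw [this, be_sq]; ring_nf; rw [rt2_sq]; ring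

/-- (Ported verbatim from the HodgeCMPerL package; no docstring in the source.) -/
theorem al_ne_zero : al ≠ 0 := by
  have h : (0:ℝ) < 3 + Real.sqrt 2 := by positivity
  simp [al, I_ne_zero, Real.sqrt_ne_zero'.mpr h]

/-- (Ported verbatim from the HodgeCMPerL package; no docstring in the source.) -/
theorem be_ne_zero : be ≠ 0 := by
  have h : (0:ℝ) < 3 - Real.sqrt 2 := by linarith [sqrt2_lt_three]
  simp [be, I_ne_zero, Real.sqrt_ne_zero'.mpr h]

/-- `α·β = −√7` is real -/
theorem al_mul_be : al * be = -((Real.sqrt 7 : ℝ) : ℂ) := by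
  have h1 : (0:ℝ) ≤ 3 + Real.sqrt 2 := by positivity
  have h2 : (0:ℝ) ≤ 3 - Real.sqrt 2 := by linarith [sqrt2_lt_three]
  have h3 : Real.sqrt (3 + Real.sqrt 2) * Real.sqrt (3 - Real.sqrt 2) = Real.sqrt 7 := by
    rw [← Real.sqrt_mul h1]
    congr 1
    have := Real.sq_sqrt (show (0:ℝ) ≤ 2 by norm_num)
    nlinarith
  calc al * be = I ^ 2 * ((Real.sqrt (3 + Real.sqrt 2) * Real.sqrt (3 - Real.sqrt 2) : ℝ) : ℂ) := by
        simp only [al, be]; push_cast; ring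
    _ = -((Real.sqrt 7 : ℝ) : ℂ) := by rw [h3, I_sq]; ring

/-- no real number is a root of the quartic: its roots are non-real -/
theorem conj_ne_of_quartic {z : ℂ} (hz : z ^ 4 + 6 * z ^ 2 + 7 = 0) : (starRingEnd ℂ) z ≠ z := by
  intro h
  obtain ⟨x, rfl⟩ := conj_eq_iff_real.mp h
  have h1 : ((x ^ 4 + 6 * x ^ 2 + 7 : ℝ) : ℂ) = 0 := by push_cast; exact hz
  have h2 : x ^ 4 + 6 * x ^ 2 + 7 = 0 := by exact_mod_cast h1
  nlinarith [sq_nonneg x, sq_nonneg (x ^ 2)]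

/-- (Ported verbatim from the HodgeCMPerL package; no docstring in the source.) -/
theorem conj_al : (starRingEnd ℂ) al ≠ al := conj_ne_of_quartic al_quartic

/-- `√2 ∉ ℚ` inside `ℂ` -/
theorem rt2_ne_ratCast (q : ℚ) : rt2 ≠ (q : ℂ) := by
  intro h
  have h1 : Real.sqrt 2 = (q : ℝ) := by
    have := congrArg Complex.re h
    simpa [rt2] using this
  exact irrational_sqrt_two.ne_rat q h1

/-! ## §2 The subfields `ℚ(√2) ≤ ℚ(α)` of `ℂ`; irreducibility; `√7 ∉ ℚ(√2)` -/

/-- the real numbers as an intermediate field of `ℂ / ℚ` -/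
def realIF : IntermediateField ℚ ℂ where
  carrier := {z | (starRingEnd ℂ) z = z}
  mul_mem' ha hb := by simp only [Set.mem_setOf_eq, map_mul] at *; rw [ha, hb]
  one_mem' := by simp
  add_mem' ha hb := by simp only [Set.mem_setOf_eq, map_add] at *; rw [ha, hb]
  zero_mem' := by simp
  algebraMap_mem' q := by simp
  inv_mem' x hx := by simp only [Set.mem_setOf_eq, map_inv₀] at *; rw [hx]

/-- (Ported verbatim from the HodgeCMPerL package; no docstring in the source.) -/
@[simp] theorem mem_realIF {z : ℂ} : z ∈ realIF ↔ (starRingEnd ℂ) z = z := Iff.rfl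

/-- (Ported verbatim from the HodgeCMPerL package; no docstring in the source.) -/
theorem ofReal_mem_realIF (x : ℝ) : (x : ℂ) ∈ realIF := conj_ofReal x

/-- (Ported verbatim from the HodgeCMPerL package; no docstring in the source.) -/
theorem rt2_mem_realIF : rt2 ∈ realIF := ofReal_mem_realIF _

/-- (Ported verbatim from the HodgeCMPerL package; no docstring in the source.) -/
theorem al_not_mem_realIF : al ∉ realIF := conj_al

/-- (Ported verbatim from the HodgeCMPerL package; no docstring in the source.) -/
theorem isIntegral_rt2 : IsIntegral ℚ rt2 := by
  refine ⟨X ^ 2 - C 2, monic_X_pow_sub_C _ two_ne_zero, ?_⟩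
  simp [rt2_sq]

/-- (Ported verbatim from the HodgeCMPerL package; no docstring in the source.) -/
theorem isIntegral_al : IsIntegral ℚ al := by
  refine ⟨quartic, quartic_monic, ?_⟩
  rw [eval₂_quartic]; exact al_quartic

/-- (Ported verbatim from the HodgeCMPerL package; no docstring in the source.) -/
instance finiteDimensional_adjoin_rt2 : FiniteDimensional ℚ ℚ⟮rt2⟯ := adjoin.finiteDimensional isIntegral_rt2
/-- (Ported verbatim from the HodgeCMPerL package; no docstring in the source.) -/
instance finiteDimensional_adjoin_al : FiniteDimensional ℚ ℚ⟮al⟯ := adjoin.finiteDimensional isIntegral_al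

/-- `[ℚ(√2) : ℚ] = 2` -/
theorem finrank_rt2 : finrank ℚ ℚ⟮rt2⟯ = 2 := by
  have hle : finrank ℚ ℚ⟮rt2⟯ ≤ 2 := by
    rw [adjoin.finrank isIntegral_rt2]
    have h := minpoly.degree_le_of_ne_zero ℚ rt2 (p := X ^ 2 - C 2) (X_pow_sub_C_ne_zero two_pos _)
      (by simp [rt2_sq])
    rw [degree_X_pow_sub_C two_pos] at h
    exact natDegree_le_iff_degree_le.mpr h
  have hne : finrank ℚ ℚ⟮rt2⟯ ≠ 1 := by
    intro h1
    have hbot : ℚ⟮rt2⟯ = ⊥ := finrank_eq_one_iff.mp h1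
    have hmem : rt2 ∈ (⊥ : IntermediateField ℚ ℂ) := hbot ▸ mem_adjoin_simple_self ℚ rt2
    obtain ⟨q, hq⟩ := mem_bot.mp hmem
    exact rt2_ne_ratCast q (by simpa using hq.symm)
  have hpos : 0 < finrank ℚ ℚ⟮rt2⟯ := finrank_pos
  omega

/-- (Ported verbatim from the HodgeCMPerL package; no docstring in the source.) -/
theorem rt2_mem_adjoin_al : rt2 ∈ ℚ⟮al⟯ := by
  have h : rt2 = -(al ^ 2) - 3 := by rw [al_sq]; ring
  rw [h]
  exact sub_mem (neg_mem (pow_mem (mem_adjoin_simple_self ℚ al) 2)) (ofNat_mem _ 3)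

/-- (Ported verbatim from the HodgeCMPerL package; no docstring in the source.) -/
theorem adjoin_rt2_le_adjoin_al : ℚ⟮rt2⟯ ≤ ℚ⟮al⟯ := adjoin_simple_le_iff.mpr rt2_mem_adjoin_al

/-- `[ℚ(α) : ℚ] = 4` -/
theorem finrank_al : finrank ℚ ℚ⟮al⟯ = 4 := by
  have hle : finrank ℚ ℚ⟮al⟯ ≤ 4 := by
    rw [adjoin.finrank isIntegral_al]
    have h := minpoly.degree_le_of_ne_zero ℚ al quartic_ne_zero
      (by rw [aeval_def, eval₂_quartic]; exact al_quartic)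
    have h' := natDegree_le_natDegree h
    rwa [natDegree_quartic] at h'
  have hdvd : 2 ∣ finrank ℚ ℚ⟮al⟯ := finrank_rt2 ▸ finrank_dvd_of_le_right adjoin_rt2_le_adjoin_al
  have hne : finrank ℚ ℚ⟮al⟯ ≠ 2 := by
    intro h2
    have heq : ℚ⟮rt2⟯ = ℚ⟮al⟯ := eq_of_le_of_finrank_eq adjoin_rt2_le_adjoin_al (finrank_rt2.trans h2.symm)
    have : al ∈ ℚ⟮rt2⟯ := heq ▸ mem_adjoin_simple_self ℚ al
    exact al_not_mem_realIF (adjoin_simple_le_iff.mpr rt2_mem_realIF this)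
  have hpos : 0 < finrank ℚ ℚ⟮al⟯ := finrank_pos
  omega

/-- (Ported verbatim from the HodgeCMPerL package; no docstring in the source.) -/
theorem minpoly_al : minpoly ℚ al = quartic := by
  symm
  refine eq_of_monic_of_dvd_of_natDegree_le (minpoly.monic isIntegral_al) quartic_monic
    (minpoly.dvd ℚ al (by rw [aeval_def, eval₂_quartic]; exact al_quartic)) ?_
  rw [natDegree_quartic, ← adjoin.finrank isIntegral_al, finrank_al]

/-- `X⁴ + 6X² + 7` is irreducible over `ℚ` -/
theorem quartic_irreducible : Irreducible quartic := minpoly_al ▸ minpoly.irreducible isIntegral_al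

/-- (Ported verbatim from the HodgeCMPerL package; no docstring in the source.) -/
theorem irrational_sqrt7 : Irrational (Real.sqrt 7) := Nat.Prime.irrational_sqrt (by norm_num)

/-- (Ported verbatim from the HodgeCMPerL package; no docstring in the source.) -/
theorem irrational_sqrt14 : Irrational (Real.sqrt 14) := by
  have h : ¬ IsSquare (14 : ℕ) := by
    rintro ⟨r, hr⟩
    have : r ≤ 3 := by nlinarith
    interval_cases r <;> omega
  simpa using irrational_sqrt_natCast_iff.mpr h

/-- `√7 ∉ ℚ(√2)`: the arithmetic heart of non-normality (`7 ∉ ℚ(√2)²`) -/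
theorem sqrt7_not_mem_adjoin_rt2 : ((Real.sqrt 7 : ℝ) : ℂ) ∉ ℚ⟮rt2⟯ := by
  intro hmem
  set pb := adjoin.powerBasis isIntegral_rt2 with hpb
  have hdim : pb.dim = 2 := by
    rw [hpb, adjoin.powerBasis_dim, ← adjoin.finrank isIntegral_rt2, finrank_rt2]
  obtain ⟨f, hf, hy⟩ := pb.exists_eq_aeval ⟨_, hmem⟩
  rw [hdim] at hf
  set a : ℚ := f.coeff 1 with ha
  set b : ℚ := f.coeff 0 with hb
  have hf1 : f = C a * X + C b := eq_X_add_C_of_natDegree_le_one (by omega)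
  have key : ((Real.sqrt 7 : ℝ) : ℂ) = (a : ℂ) * rt2 + (b : ℂ) := by
    have h := congrArg (algebraMap ℚ⟮rt2⟯ ℂ) hy
    rw [← aeval_algebraMap_apply, hpb, adjoin.powerBasis_gen, AdjoinSimple.algebraMap_gen, hf1] at h
    simpa using h
  -- square both sides: 7 = 2a² + b² + 2ab√2
  have hsq : (7 : ℂ) = ((a : ℂ) * rt2 + b) ^ 2 := by
    rw [← key, ← ofReal_pow, Real.sq_sqrt (by norm_num : (0:ℝ) ≤ 7)]; norm_cast
  have hsq' : (7 : ℂ) = 2 * a ^ 2 + b ^ 2 + 2 * a * b * rt2 := by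
    rw [hsq]; linear_combination ((a : ℂ)) ^ 2 * rt2_sq
  by_cases hab : a * b = 0
  · -- then `7 = b²` or `7 = 2a²` in `ℚ`, impossible
    have h7 : (2 * a ^ 2 + b ^ 2 : ℚ) = 7 := by
      have habC : (a : ℂ) * b = 0 := by exact_mod_cast hab
      have : ((2 * a ^ 2 + b ^ 2 : ℚ) : ℂ) = 7 := by
        push_cast
        linear_combination (-2 * rt2) * habC - hsq'
      exact_mod_cast this
    rcases mul_eq_zero.mp hab with ha0 | hb0
    · have h7' : (b : ℝ) ^ 2 = 7 := by
        have : b ^ 2 = (7 : ℚ) := by rw [ha0] at h7; linear_combination h7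
        exact_mod_cast this
      apply irrational_sqrt7.ne_rat |b|
      rw [← h7', Real.sqrt_sq_eq_abs, Rat.cast_abs]
    · have h7' : ((2 * a : ℚ) : ℝ) ^ 2 = 14 := by
        have : (2 * a) ^ 2 = (14 : ℚ) := by rw [hb0] at h7; linear_combination 2 * h7
        exact_mod_cast this
      apply irrational_sqrt14.ne_rat |2 * a|
      rw [← h7', Real.sqrt_sq_eq_abs, Rat.cast_abs]
  · -- then `√2 = (7 - 2a² - b²)/(2ab) ∈ ℚ`
    have hab' : (2 : ℂ) * a * b ≠ 0 := by
      rw [mul_assoc]; exact mul_ne_zero two_ne_zero (by exact_mod_cast hab)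
    apply rt2_ne_ratCast ((7 - 2 * a ^ 2 - b ^ 2) / (2 * a * b))
    push_cast
    rw [eq_div_iff hab']
    linear_combination -hsq'

/-! ## §3 `β ∉ ℚ(α)` and the number field `K = ℚ[X]/(X⁴ + 6X² + 7)` -/

/-- **`β ∉ ℚ(α)`**: the conjugate root `β = i√(3 − √2)` does not lie in `ℚ(α)`, because
`α·β = −√7 ∉ ℚ(√2) = ℚ(α) ∩ ℝ`. -/
theorem be_not_mem_adjoin_al : be ∉ ℚ⟮al⟯ := by
  intro hbe
  have ht : al * be ∈ ℚ⟮al⟯ := mul_mem (mem_adjoin_simple_self ℚ al) hbe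
  rw [al_mul_be] at ht
  set m7 : ℂ := -((Real.sqrt 7 : ℝ) : ℂ) with hm7
  set M : IntermediateField ℚ ℂ := IntermediateField.adjoin ℚ {rt2, m7} with hM
  have hMle : M ≤ ℚ⟮al⟯ := adjoin_le_iff.mpr (by
    rintro _ (rfl | rfl)
    exacts [rt2_mem_adjoin_al, ht])
  have hMreal : M ≤ realIF := adjoin_le_iff.mpr (by
    rintro _ (rfl | rfl)
    exacts [rt2_mem_realIF, neg_mem (ofReal_mem_realIF _)])
  have h2M : ℚ⟮rt2⟯ ≤ M := adjoin.mono _ _ _ (by simp)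
  have hdvd4 : finrank ℚ M ∣ 2 ^ 2 := by
    have h := finrank_dvd_of_le_right hMle
    rwa [finrank_al] at h
  have hdvd2 : 2 ∣ finrank ℚ M := finrank_rt2 ▸ finrank_dvd_of_le_right h2M
  have hne2 : finrank ℚ M ≠ 2 := by
    intro h2
    haveI : FiniteDimensional ℚ M := Module.finite_of_finrank_eq_succ h2
    have heq : ℚ⟮rt2⟯ = M := eq_of_le_of_finrank_eq h2M (finrank_rt2.trans h2.symm)
    have hm : m7 ∈ ℚ⟮rt2⟯ := by
      rw [heq]; exact subset_adjoin ℚ _ (by simp)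
    exact sqrt7_not_mem_adjoin_rt2 (by simpa [hm7] using neg_mem hm)
  obtain ⟨k, hk, hfk⟩ := (Nat.dvd_prime_pow Nat.prime_two).mp hdvd4
  have h4 : finrank ℚ M = 4 := by
    interval_cases k
    · rw [hfk] at hdvd2; omega
    · exact absurd hfk hne2
    · rw [hfk]; norm_num
  have hMeq : M = ℚ⟮al⟯ := eq_of_le_of_finrank_eq hMle (h4.trans finrank_al.symm)
  have hal : al ∈ M := hMeq ▸ mem_adjoin_simple_self ℚ al
  exact al_not_mem_realIF (hMreal hal)

end D4

end HodgeCM.Toy
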